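import Summits.KontsevichZagierPeriods.KontsevichZagierPeriods.Theses.HurwitzMicroSectors
import Literature.NumberTheory.Transcendental.CalegariDimitrovTangL2Chi3
import Literature.NumberTheory.Transcendental.BoxIntegralHurwitzWeightTwo
import Literature.NumberTheory.Transcendental.KZLogCalculusProofs
import Literature.NumberTheory.Transcendental.KZRelationsLE
import Literature.NumberTheory.Transcendental.KZMellinFibres
import Literature.NumberTheory.Transcendental.BoxCoordinatePowerMap

/-!
# Crux SectorTwoSix (stmt-3870) — ideator 1: the five `Targets` of `Disproof.lean` are instances of
ONE schema (the `n = 2` dilation), which holds — STANDALONE CHECK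

`Cruxes/SectorTwoSix/Disproof.lean` (standing disprover, sorry-free) proves
`sectorTwoSix_of_targets : Targets → SectorTwoSix`, `Targets := (∀ k, TMono k) ∧ TDil2 0 ∧ TDil2 1 ∧ TDil2 2 ∧ TDil3 1`.
That module is not yet built on the farm, so this file COPIES VERBATIM its §0/§3/§6 definitions
(`box`, `sectorFun`, `constRep`, `sectorRep`, `monoRep`, `TMono`, `TDil2`, `TDil3`, `Targets`) into
namespace `…Ideator1S` and proves: `DilationMoveTwo` (from the tree's `BoxCoordinatePowerMap.lean` +
`isSemialgebraicMapOn_aeval`) and `DilationMoveTwo → Targets` — lever A (`TMono k` is ONE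
change-of-variables move, `m = k+1`, constant target). The sibling file `SketchTargets.lean`
(same proofs, importing the Disproof) closes `SectorTwoSix` via `sectorTwoSix_of_targets` once the
module is built.
-/

noncomputable section

set_option linter.dupNamespace false

open Set MeasureTheory
open Literature.NumberTheory.Transcendental

namespace Summit.KontsevichZagierPeriods.KontsevichZagierPeriods.Cruxes.SectorTwoSix.Ideator1S

open Summit.KontsevichZagierPeriods.KontsevichZagierPeriods.Theses.HurwitzMicroSectors (SectorTwoSix DilationMove)

/-! ## Verbatim from Disproof.lean §0, §1 (polynomials), §3, §6 (targets) -/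

/-- The open unit box `(0,1)²`, literally as inlined in the crux. -/
def box : Set (Fin 2 → ℝ) := {x | ∀ i, x i ∈ Set.Ioo (0:ℝ) 1}

/-- The sector integrand `P(x₀x₁)/(1 − (x₀x₁)⁶)`, literally as inlined in the crux. -/
def sectorFun (P : Polynomial ℚ) (x : Fin 2 → ℝ) : ℝ :=
  Polynomial.aeval (x 0 * x 1) P / (1 - (x 0 * x 1) ^ 6)

/-- The conclusion of the crux with the CDT antecedent dropped: Conjecture 1 on the level-6 weight-2
box sector. -/
def Conclusion : Prop :=
  ∀ (r r' : KZ.IntegralRep 2) (P P' : Polynomial ℚ), r.domain = box → r'.domain = box →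
    EqOn r.integrand (sectorFun P) r.domain → EqOn r'.integrand (sectorFun P') r'.domain →
    r.value = r'.value → KZ.Equivalent r r'

/-- Read-back (`Iff.rfl`): the crux is `CDT → Conclusion`, the antecedent being literally the named
fact `calegariDimitrovTang_linearIndependent`. -/
theorem crux_iff : SectorTwoSix ↔ (calegariDimitrovTang_linearIndependent → Conclusion) := Iff.rfl

/-- On the box `t = x₀x₁ ∈ (0,1)`. -/
theorem mul_mem_Ioo {x : Fin 2 → ℝ} (hx : x ∈ box) : x 0 * x 1 ∈ Ioo (0:ℝ) 1 :=
  BoxIntegral.mul_mem_Ioo_of_mem_box hx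

/-- On the box the denominator `1 − t⁶` is positive. -/
theorem den_pos {x : Fin 2 → ℝ} (hx : x ∈ box) : 0 < 1 - (x 0 * x 1) ^ 6 := by
  have ht := mul_mem_Ioo hx
  have : (x 0 * x 1) ^ 6 < 1 := pow_lt_one₀ ht.1.le ht.2 (by norm_num)
  linarith
/-- The two-variable polynomial `P(X₀X₁)`. -/
def numPoly (P : Polynomial ℚ) : MvPolynomial (Fin 2) ℚ :=
  Polynomial.aeval (MvPolynomial.X 0 * MvPolynomial.X 1 : MvPolynomial (Fin 2) ℚ) P

/-- The denominator `1 − (X₀X₁)⁶`. -/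
def denPoly : MvPolynomial (Fin 2) ℚ := 1 - (MvPolynomial.X 0 * MvPolynomial.X 1) ^ 6

@[simp] theorem aeval_numPoly (P : Polynomial ℚ) (x : Fin 2 → ℝ) :
    MvPolynomial.aeval x (numPoly P) = Polynomial.aeval (x 0 * x 1) P := by
  unfold numPoly
  rw [← Polynomial.aeval_algHom_apply]
  simp

@[simp] theorem aeval_denPoly (x : Fin 2 → ℝ) :
    MvPolynomial.aeval x denPoly = 1 - (x 0 * x 1) ^ 6 := by
  simp [denPoly]

/-- The box is `ℚ`-semialgebraic (tree: `KZ.isSemialgebraic_box`). -/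
theorem isSemialgebraic_box : Literature.ModelTheory.ExponentialFields.IsSemialgebraic ℚ box :=
  KZ.isSemialgebraic_box 2

/-- The box is measurable. -/
theorem measurableSet_box : MeasurableSet box := Beukers.measurableSet_cube 2

/-- The constant representation `[box, a]`, `a ∈ ℚ`. -/
def constRep (a : ℚ) : KZ.IntegralRep 2 where
  domain := box
  integrand := fun _ => (a : ℝ)
  isSemialgebraic_domain := isSemialgebraic_box
  isSemialgebraicFunOn_integrand :=
    (isSemialgebraicFunOn_aeval isSemialgebraic_box (MvPolynomial.C a)).congr fun x _ => by simp
  integrableOn := BoxIntegral.integrableOn_box_const 2 a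

@[simp] theorem constRep_domain (a : ℚ) : (constRep a).domain = box := rfl
@[simp] theorem constRep_integrand (a : ℚ) : (constRep a).integrand = fun _ => (a : ℝ) := rfl

/-- Integrability of the sector integrand: a finite `ℚ`-combination of the Hurwitz kernels
`tᵏ/(1 − t⁶)`, each integrable on the box (tree: `BoxIntegral.integrableOn_box_pow_div_one_sub_pow`). -/
theorem integrableOn_sectorFun (P : Polynomial ℚ) : IntegrableOn (sectorFun P) box volume := by
  have hsum : IntegrableOn (fun x : Fin 2 → ℝ => ∑ i ∈ Finset.range (P.natDegree + 1),
      (P.coeff i : ℝ) * ((x 0 * x 1) ^ i / (1 - (x 0 * x 1) ^ 6))) box volume := by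
    refine integrable_finsetSum _ fun i _ => ?_
    exact (BoxIntegral.integrableOn_box_pow_div_one_sub_pow (by norm_num : 1 ≤ 6) i).const_mul _
  refine hsum.congr_fun (fun x _ => ?_) measurableSet_box
  simp only [sectorFun]
  rw [Polynomial.aeval_eq_sum_range, Finset.sum_div]
  refine Finset.sum_congr rfl fun i _ => ?_
  rw [Rat.smul_def, ← eq_ratCast (algebraMap ℚ ℝ), mul_div_assoc]

/-- **The sector representation `[box, P(t)/(1 − t⁶)]`** for every `P ∈ ℚ[t]`: the universally
quantified `r` of the crux is inhabited for every numerator, so the crux is not vacuous. -/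
def sectorRep (P : Polynomial ℚ) : KZ.IntegralRep 2 where
  domain := box
  integrand := sectorFun P
  isSemialgebraic_domain := isSemialgebraic_box
  isSemialgebraicFunOn_integrand :=
    (isSemialgebraicFunOn_aeval_div_aeval isSemialgebraic_box (numPoly P) denPoly
      (fun x hx => by rw [aeval_denPoly]; exact (den_pos hx).ne')).congr fun x _ => by
        simp only [aeval_numPoly, aeval_denPoly, sectorFun]
  integrableOn := integrableOn_sectorFun P

@[simp] theorem sectorRep_domain (P : Polynomial ℚ) : (sectorRep P).domain = box := rfl
@[simp] theorem sectorRep_integrand (P : Polynomial ℚ) : (sectorRep P).integrand = sectorFun P := rfl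


section Engine

open Polynomial

/-- The monomial representation `[box, tᵏ]`. -/
def monoRep (k : ℕ) : KZ.IntegralRep 2 where
  domain := box
  integrand := fun x => (x 0 * x 1) ^ k
  isSemialgebraic_domain := isSemialgebraic_box
  isSemialgebraicFunOn_integrand :=
    (isSemialgebraicFunOn_aeval isSemialgebraic_box
      ((MvPolynomial.X 0 * MvPolynomial.X 1 : MvPolynomial (Fin 2) ℚ) ^ k)).congr fun x _ => by simp
  integrableOn := BoxIntegral.integrableOn_box_mul_pow k

@[simp] theorem monoRep_domain (k : ℕ) : (monoRep k).domain = box := rfl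
@[simp] theorem monoRep_integrand (k : ℕ) : (monoRep k).integrand = fun x => (x 0 * x 1) ^ k := rfl

/-- `[box, tᵏ]` has value `(k+1)⁻²`. -/
@[simp] theorem value_monoRep (k : ℕ) : (monoRep k).value = 1 / ((k : ℝ) + 1) ^ 2 :=
  BoxIntegral.setIntegral_box_mul_pow k

/-- Target: the monomial descent `[box, tᵏ] ∼ [box, (k+1)⁻²]` (two Newton–Leibniz moves down to
dimension `0` and two back, polynomial primitives). -/
def TMono (k : ℕ) : Prop :=
  KZ.of (monoRep k) - KZ.of (constRep (1 / ((k : ℚ) + 1) ^ 2)) ∈ KZ.relations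

/-- Target: the `m = 2` dilation (crux `DilationMove`, `n = 2`), source `4t^{2r+1}/(1−t⁶)`, target
`(tʳ + t^{r+3})/(1−t⁶) = tʳ/(1−t³)`. -/
def TDil2 (r : ℕ) : Prop :=
  KZ.of (sectorRep (4 * X ^ (2 * r + 1))) - KZ.of (sectorRep (X ^ r + X ^ (r + 3))) ∈ KZ.relations

/-- Target: the `m = 3` dilation, source `9t^{3r+2}/(1−t⁶)`, target
`(tʳ + t^{r+2} + t^{r+4})/(1−t⁶) = tʳ/(1−t²)`. -/
def TDil3 (r : ℕ) : Prop :=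
  KZ.of (sectorRep (9 * X ^ (3 * r + 2))) - KZ.of (sectorRep (X ^ r + X ^ (r + 2) + X ^ (r + 4)))
    ∈ KZ.relations

/-- The conjunction of targets actually used. -/
def Targets : Prop := (∀ k, TMono k) ∧ TDil2 0 ∧ TDil2 1 ∧ TDil2 2 ∧ TDil3 1

/-! ## New (ideator 1): the schema, its proof, and the five targets as instances -/

/-- The `n = 2` dilation schema: `[box, f ∘ Φₘ · m² (x₀x₁)^{m−1}] − [box, f]` is one
change-of-variables move (`Φₘ(x) = (x₀ᵐ, x₁ᵐ)`), for every `m ≥ 1`. Route item DilationMove (3872)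
at `n = 2`. -/
def DilationMoveTwo : Prop :=
  ∀ (m : ℕ), 1 ≤ m → ∀ (r r' : KZ.IntegralRep 2),
    r.domain = {x | ∀ i, x i ∈ Set.Ioo (0:ℝ) 1} → r'.domain = {x | ∀ i, x i ∈ Set.Ioo (0:ℝ) 1} →
    (∀ x ∈ r.domain, r.integrand x = r'.integrand (fun i => x i ^ m) * ((m : ℝ) ^ 2 * ∏ i, x i ^ (m - 1))) →
    KZ.of r - KZ.of r' ∈ KZ.changeOfVariablesRel

theorem dilationMoveTwo_of_dilationMove (h : DilationMove) : DilationMoveTwo :=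
  fun m hm r r' hr hr' hf => h 2 m hm r r' hr hr' hf

/-- **The schema holds** (packaging of `BoxCoordinatePowerMap.lean`). -/
theorem dilationMoveTwo_holds : DilationMoveTwo := by
  intro m hm r r' hr hr' hf
  have hm0 : m ≠ 0 := by omega
  have hfun : (fun (x : Fin 2 → ℝ) (j : Fin 2) =>
      MvPolynomial.aeval x ((MvPolynomial.X j : MvPolynomial (Fin 2) ℚ) ^ m)) =
      BoxIntegral.coordPow (n := 2) m := by
    funext x j
    simp [BoxIntegral.coordPow]
  have hΦ : IsSemialgebraicMapOn ℚ {x : Fin 2 → ℝ | ∀ j, x j ∈ Set.Ioo (0:ℝ) 1}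
      (BoxIntegral.coordPow (n := 2) m) :=
    hfun ▸ isSemialgebraicMapOn_aeval (KZ.isSemialgebraic_box 2) _
  refine ⟨2, r, r', BoxIntegral.coordPow m, BoxIntegral.coordPowDeriv m, ?_, ?_, ?_, ?_, ?_, rfl⟩
  · rw [hr]; exact hΦ
  · intro x _; exact BoxIntegral.hasFDerivWithinAt_coordPow m _ x
  · rw [hr]; exact BoxIntegral.injOn_coordPow_box hm0
  · rw [hr, hr']; exact (BoxIntegral.image_coordPow_box hm0).symm
  · intro x hx
    have hxb : ∀ i, x i ∈ Set.Ioo (0:ℝ) 1 := by rw [hr] at hx; exact hx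
    rw [hf x hx, BoxIntegral.abs_det_coordPowDeriv hm0 hxb]
    rfl

/-- **Lever A: `TMono k` is ONE move** (`m = k+1`, constant target integrand). -/
theorem tMono_of_dilationMoveTwo (hD : DilationMoveTwo) (k : ℕ) : TMono k := by
  refine KZ.changeOfVariablesRel_subset_relations
    (hD (k + 1) (by omega) (monoRep k) (constRep _) rfl rfl fun x hx => ?_)
  simp only [monoRep_integrand, constRep_integrand, Nat.add_sub_cancel, Fin.prod_univ_two]
  have hk : ((k : ℝ) + 1) ≠ 0 := by positivity
  push_cast
  field_simp
  ring

/-- The `m = 2` distribution target from the schema. -/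
theorem tDil2_of_dilationMoveTwo (hD : DilationMoveTwo) (r : ℕ) : TDil2 r := by
  refine KZ.changeOfVariablesRel_subset_relations
    (hD 2 (by norm_num) (sectorRep (4 * X ^ (2 * r + 1))) (sectorRep (X ^ r + X ^ (r + 3))) rfl rfl
      fun x hx => ?_)
  have hxb : x ∈ box := hx
  have ht := mul_mem_Ioo hxb
  have h6 : (1 - (x 0 * x 1) ^ 6 : ℝ) ≠ 0 := (den_pos hxb).ne'
  have hlt : (x 0 * x 1) ^ 6 < 1 := pow_lt_one₀ ht.1.le ht.2 (by norm_num)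
  have hnn : 0 ≤ (x 0 * x 1) ^ 6 := by positivity
  have h12 : (1 - (x 0 ^ 2 * x 1 ^ 2) ^ 6 : ℝ) ≠ 0 := by
    have h' : (x 0 ^ 2 * x 1 ^ 2) ^ 6 = ((x 0 * x 1) ^ 6) ^ 2 := by ring
    have h'' : ((x 0 * x 1) ^ 6) ^ 2 < 1 := pow_lt_one₀ hnn hlt (by norm_num)
    rw [h']
    exact (sub_pos.mpr h'').ne'
  simp only [sectorRep_integrand, sectorFun, map_mul, map_add, map_pow, aeval_X, map_ofNat,
    Fin.prod_univ_two, show (2:ℕ) - 1 = 1 from rfl, pow_one]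
  rw [div_mul_eq_mul_div, div_eq_div_iff h6 h12]
  ring

/-- The `m = 3` distribution target from the schema. -/
theorem tDil3_of_dilationMoveTwo (hD : DilationMoveTwo) (r : ℕ) : TDil3 r := by
  refine KZ.changeOfVariablesRel_subset_relations
    (hD 3 (by norm_num) (sectorRep (9 * X ^ (3 * r + 2)))
      (sectorRep (X ^ r + X ^ (r + 2) + X ^ (r + 4))) rfl rfl fun x hx => ?_)
  have hxb : x ∈ box := hx
  have ht := mul_mem_Ioo hxb
  have h6 : (1 - (x 0 * x 1) ^ 6 : ℝ) ≠ 0 := (den_pos hxb).ne'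
  have hlt : (x 0 * x 1) ^ 6 < 1 := pow_lt_one₀ ht.1.le ht.2 (by norm_num)
  have hnn : 0 ≤ (x 0 * x 1) ^ 6 := by positivity
  have h18 : (1 - (x 0 ^ 3 * x 1 ^ 3) ^ 6 : ℝ) ≠ 0 := by
    have h' : (x 0 ^ 3 * x 1 ^ 3) ^ 6 = ((x 0 * x 1) ^ 6) ^ 3 := by ring
    have h'' : ((x 0 * x 1) ^ 6) ^ 3 < 1 := pow_lt_one₀ hnn hlt (by norm_num)
    rw [h']
    exact (sub_pos.mpr h'').ne'
  simp only [sectorRep_integrand, sectorFun, map_mul, map_add, map_pow, aeval_X, map_ofNat,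
    Fin.prod_univ_two, show (3:ℕ) - 1 = 2 from rfl]
  rw [div_mul_eq_mul_div, div_eq_div_iff h6 h18]
  ring

/-- **Route item DilationMove (stmt-3872) itself, every dimension `n`**, by the same packaging of the
tree's `BoxCoordinatePowerMap.lean` (general `n` there) + `isSemialgebraicMapOn_aeval`. -/
theorem dilationMove_holds : DilationMove := by
  intro n m hm r r' hr hr' hf
  have hm0 : m ≠ 0 := by omega
  have hfun : (fun (x : Fin n → ℝ) (j : Fin n) =>
      MvPolynomial.aeval x ((MvPolynomial.X j : MvPolynomial (Fin n) ℚ) ^ m)) =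
      BoxIntegral.coordPow (n := n) m := by
    funext x j
    simp [BoxIntegral.coordPow]
  have hΦ : IsSemialgebraicMapOn ℚ {x : Fin n → ℝ | ∀ j, x j ∈ Set.Ioo (0:ℝ) 1}
      (BoxIntegral.coordPow (n := n) m) :=
    hfun ▸ isSemialgebraicMapOn_aeval (KZ.isSemialgebraic_box n) _
  refine ⟨n, r, r', BoxIntegral.coordPow m, BoxIntegral.coordPowDeriv m, ?_, ?_, ?_, ?_, ?_, rfl⟩
  · rw [hr]; exact hΦ
  · intro x _; exact BoxIntegral.hasFDerivWithinAt_coordPow m _ x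
  · rw [hr]; exact BoxIntegral.injOn_coordPow_box hm0
  · rw [hr, hr']; exact (BoxIntegral.image_coordPow_box hm0).symm
  · intro x hx
    have hxb : ∀ i, x i ∈ Set.Ioo (0:ℝ) 1 := by rw [hr] at hx; exact hx
    rw [hf x hx, BoxIntegral.abs_det_coordPowDeriv hm0 hxb]
    rfl

/-- **All five targets from the one schema.** -/
theorem targets_of_dilationMoveTwo (hD : DilationMoveTwo) : Targets :=
  ⟨tMono_of_dilationMoveTwo hD, tDil2_of_dilationMoveTwo hD 0, tDil2_of_dilationMoveTwo hD 1,
    tDil2_of_dilationMoveTwo hD 2, tDil3_of_dilationMoveTwo hD 1⟩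

/-- Hence the targets hold outright. -/
theorem targets_holds : Targets := targets_of_dilationMoveTwo dilationMoveTwo_holds

end Engine

end Summit.KontsevichZagierPeriods.KontsevichZagierPeriods.Cruxes.SectorTwoSix.Ideator1S
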